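import Literature.NumberTheory.GaloisCohomology.Howard2004.DVRSettingEngineLocalInputsProofs
import Literature.NumberTheory.GaloisCohomology.Howard2004.InertTransverseDecompositionOfUnitsProofs
import HarnessLib

/-!
# Howard 2004, §1.6 on a `DVRSetting`: the Prop. 1.1.9 letters at `q ∈ 𝓛^{(j)}` for EVERY imaginary quadratic `K`
# with `p ∤ #𝓞_K^×` — the `d_K < −4` of `DVRSettingEngineLocalInputsProofs` removed (proofs file)

Topic `NumberTheory/GaloisCohomology/Howard2004` (sequel to `DVRSettingEngineLocalInputsProofs` (§2 there: Prop. 1.1.9 at the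
level under `hd : NumberField.discr K < -4`) and `InertTransverseDecompositionOfUnitsProofs` (Prop. 1.1.9 under
`hu : ¬ p ∣ Nat.card (𝓞 K)ˣ`)).  THEOREMS ONLY: no definition, no named fact, no instance, no notation, no `sorry`.

SOURCE / WHY.  B. Howard, *The Heegner point Kolyvagin system*, Compositio Math. **140** (2004) = arXiv:1202.6340, §1.2
(p. 6 L84–92) and Prop. 1.1.9 (p. 6 L17–25).  The cell's kernel road to the print leaf G87 (`thm161_dvrKolyvaginBound`,
Thm. 1.6.1) carried, through Prop. 1.1.9 at the level primes, the hypothesis `d_K < −4` (`#G_ℓ = ℓ + 1`); REF-167 (cell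
`pub/bsd-print-x9`, 2026-08-29) ruled it a ROAD obligation with admissible upgrade (i) «prove degree (ℓ+1)/u_K + p-Sylow
under p ∤ u_K».  With `#G_ℓ ∣ ℓ² − 1` and `ℓ + 1 ∣ #G_ℓ · #𝓞_K^×` (`EllipticCurves/RingClassGalOverCardinalityUnits`) the
letters hold for EVERY imaginary quadratic `K` with `p ∤ #𝓞_K^×` — for `p` odd this fails only at `(p, d_K) = (3, −3)`,
Howard's genuine exception («How04-2.6.1@(3,−3)-units»), and `hd ⇒ hu` (`not_dvd_card_units_of_discr_lt`).

* `DVRSetting.not_dvd_card_units_of_discr_lt` (`hd → hu` on a setting, `p` odd by T2).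
* `exists_mem_absInertia_forall_pow_inv_mul_mem_localRingClassSubgroup_of_mem_L'` — σ₀ + `hcyc` at `q ∈ 𝓛` with NO
  hypothesis on `K` beyond `S.SatisfiesH`.
* under `hu : ¬ p ∣ Nat.card (𝓞 K)ˣ`: `isCompl_unramifiedSubgroup_transverseStructure_of_mem_levelPrimes'` (Prop. 1.1.9 at
  the level), `natCard_transverseStructure_mul_eq_of_mem_levelPrimes'` (`hcard`),
  **`exists_unramified_transverse_submodules_of_mem_levelPrimes'`** (`hc`/`hef`/`hetr` in H159-LOC's shape).

NOT HERE: the re-plugging of `engine_h159` / HSYMM / H4-OF-ISO with `hu` for `hd` (their owners; one-line substitutions of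
these primed letters); `thm161_dvrKolyvaginBound` is NOT proved; no summit statement is proved; BSD is not proved by any of
this.  Seat `bsd-line-x9-p1-w3` g15, brick (HD-FREE).

References: [Howard2004HeegnerKolyvagin] §1.2, Prop. 1.1.9, §1.6 (arXiv:1202.6340 p. 6 L17–25, L84–92, p. 11 L33–44);
[GrossLMS1991] §1, §3; [Cox2013] §7.D Thm. 7.24.
-/

set_option autoImplicit false

noncomputable section

open Function NumberField IsDedekindDomain IsDedekindDomain.HeightOneSpectrum Field
open scoped NumberField

namespace Literature.NumberTheory.GaloisCohomology.Howard2004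

open Literature.NumberTheory.GaloisRepresentations
open Literature.NumberTheory.GaloisRepresentations.DiscreteGaloisModule
open Literature.NumberTheory.EllipticCurves

section DVR

variable {p : ℕ} [Fact p.Prime] {K : Type} [Field K] [NumberField K]
  {R : Type} [CommRing R] [IsDomain R] [IsDiscreteValuationRing R] [Algebra ℤ_[p] R]
  {N : ℕ → Type} [∀ k, AddCommGroup (N k)] [∀ k, TopologicalSpace (N k)]
  [∀ k, DiscreteTopology (N k)] [∀ k, Module R (N k)]
  {Rk : ℕ → Type} [∀ k, CommRing (Rk k)] [∀ k, IsLocalRing (Rk k)] [∀ k, TopologicalSpace (Rk k)]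
  [∀ k, DiscreteTopology (Rk k)] [∀ k, Algebra ℤ_[p] (Rk k)] [∀ k, Algebra R (Rk k)]
  [∀ k, Module (Rk k) (N k)] [∀ k, IsScalarTower R (Rk k) (N k)]
  {Nbar : Type} [AddCommGroup Nbar] [TopologicalSpace Nbar] [DiscreteTopology Nbar]
  [∀ k, Module (Rk k) Nbar]
  {Nq : ℕ → Finset (HeightOneSpectrum (𝓞 K)) → Type} [∀ k n, AddCommGroup (Nq k n)]
  [∀ k n, TopologicalSpace (Nq k n)] [∀ k n, DiscreteTopology (Nq k n)]
  [∀ k n, Module (Rk k) (Nq k n)] [∀ k n, Module R (Nq k n)]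
  [∀ k n, IsScalarTower R (Rk k) (Nq k n)]

namespace DVRSetting

/-- On a setting with H.0–H.5 (`p` odd, T2) the old standing hypothesis `d_K < −4` implies `p ∤ #𝓞_K^×` (`= 2`).
[cite: GrossLMS1991, §1 (PDF p. 212)] [cite: Howard2004HeegnerKolyvagin, §1 (p odd)] -/
theorem not_dvd_card_units_of_discr_lt (S : DVRSetting p K R N Rk Nbar Nq) (hy : S.SatisfiesH)
    (hd : NumberField.discr K < -4) : ¬ p ∣ Nat.card (𝓞 K)ˣ :=
  Howard2004.not_dvd_card_units_of_discr_lt hy.imagQuad hd Fact.out hy.p_odd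

/-- **A tame generator at `q ∈ 𝓛` for EVERY imaginary quadratic `K`**: `σ₀ ∈ I_{K_q}` with
`Γ_{K_q} = ⋃_i σ₀^i · (Γ_{K_q} ∩ Γ_{K[ℓ]})` — the binders `σ₀`, `hcyc` of the local files with NO hypothesis beyond
`S.SatisfiesH`. [cite: Howard2004HeegnerKolyvagin, §1.2 (arXiv:1202.6340 p. 6 L84–95)] [cite: GrossLMS1991, §3 (PDF p. 217 l. 1–3)] -/
theorem exists_mem_absInertia_forall_pow_inv_mul_mem_localRingClassSubgroup_of_mem_L'
    (S : DVRSetting p K R N Rk Nbar Nq) (hy : S.SatisfiesH) {q : HeightOneSpectrum (𝓞 K)} (hq : q ∈ S.L) :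
    ∃ σ₀ : absoluteGaloisGroup (q.adicCompletion K), σ₀ ∈ absInertia (q.adicCompletion K) ∧
      ∀ σ : absoluteGaloisGroup (q.adicCompletion K), ∃ i : ℕ,
        (σ₀ ^ i)⁻¹ * σ ∈ localRingClassSubgroup (residueChar q) S.jbar q :=
  exists_forall_pow_inv_mul_mem_localRingClassSubgroup_of_isDegreeTwo' hy.imagQuad S.jbar
    (S.isDegreeTwo_of_mem_L hy hq)

/-- **Howard Prop. 1.1.9 AT THE LEVEL for every imaginary quadratic `K` with `p ∤ #𝓞_K^×`**: for `q ∈ 𝓛^{(j)}` the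
unramified subgroup and the transverse condition of `H¹(K_q, T^{(j)})` are complementary.
[cite: Howard2004HeegnerKolyvagin, Prop. 1.1.9 and §1.6 (arXiv:1202.6340 p. 6 L17–25, p. 11 L33–38)] -/
theorem isCompl_unramifiedSubgroup_transverseStructure_of_mem_levelPrimes' (S : DVRSetting p K R N Rk Nbar Nq)
    (hy : S.SatisfiesH) (hu : ¬ p ∣ Nat.card (𝓞 K)ˣ) {j : ℕ} {q : HeightOneSpectrum (𝓞 K)}
    (hq : q ∈ S.levelPrimes j) :
    IsCompl (unramifiedSubgroup (GaloisRep.toLocal q (S.T.ρ j)) 1)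
      (transverseStructure p (S.T.ρ j) S.jbar (Sum.inr q)) := by
  haveI : Finite (N j) := S.finite_level hy j
  have hn : ↑({q} : Finset (HeightOneSpectrum (𝓞 K))) ⊆ S.levelPrimes j := by
    rw [Finset.coe_singleton, Set.singleton_subset_iff]; exact hq
  exact isCompl_unramifiedSubgroup_transverseStructure_of_isDegreeTwo_of_not_dvd_card_units p hy.imagQuad hu (S.T.ρ j)
    S.jbar (S.isDegreeTwo_of_mem_L hy hq.1)
    (fun g x => S.toLocal_apply_eq_self_of_subset_levelPrimes hy hn (Finset.mem_singleton_self q) g x)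
    (S.exists_pow_p_smul_eq_zero_level hy j) (S.residueChar_succ_smul_eq_zero_of_mem_levelPrimes hy hq)

/-- **`#H¹_tr(K_q, T^{(j)}) · #H¹_tr(K_{σq}, T^{(j)}) = #H¹(K_q, T^{(j)})`** for `q ∈ 𝓛^{(j)}`, every imaginary quadratic `K`
with `p ∤ #𝓞_K^×` (the `hcard` of H4-OF-ISO). [cite: Howard2004HeegnerKolyvagin, Prop. 1.1.9 and Lemma 1.5.6 (arXiv:1202.6340 p. 6 L17–25, p. 10 L86–88)] -/
theorem natCard_transverseStructure_mul_eq_of_mem_levelPrimes' (S : DVRSetting p K R N Rk Nbar Nq)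
    (hy : S.SatisfiesH) (hu : ¬ p ∣ Nat.card (𝓞 K)ˣ) {j : ℕ} {q : HeightOneSpectrum (𝓞 K)}
    (hq : q ∈ S.levelPrimes j) :
    Nat.card (transverseStructure p (S.T.ρ j) S.jbar (Sum.inr q)) *
        Nat.card (transverseStructure p (S.T.ρ j) S.jbar (Sum.inr (S.cd.σ • q))) =
      Nat.card (galoisCohomology ((S.T.ρ j).toLocal (Sum.inr q)) 1) := by
  haveI : Finite (N j) := S.finite_level hy j
  have hn : ↑({q} : Finset (HeightOneSpectrum (𝓞 K))) ⊆ S.levelPrimes j := by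
    rw [Finset.coe_singleton, Set.singleton_subset_iff]; exact hq
  exact natCard_transverseStructure_mul_eq_of_isDegreeTwo_of_not_dvd_card_units p hy.imagQuad hu (S.T.ρ j) S.jbar
    (S.isDegreeTwo_of_mem_L hy hq.1) (S.residueChar_sigma_smul_of_mem_L hy hq.1)
    (fun g x => S.toLocal_apply_eq_self_of_subset_levelPrimes hy hn (Finset.mem_singleton_self q) g x)
    (fun g x => S.toLocal_sigma_smul_apply_eq_self_of_subset_levelPrimes hy hn (Finset.mem_singleton_self q) g x)
    (S.exists_pow_p_smul_eq_zero_level hy j) (S.residueChar_succ_smul_eq_zero_of_mem_levelPrimes hy hq)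

/-- **Prop. 1.1.9 `R`-linearly at the level, in H159-LOC's shape (`hc`, `ef`, `etr`), for every imaginary quadratic `K`
with `p ∤ #𝓞_K^×**: `R`-submodules `SVf`, `SVtr` of `H¹(K_q, T^{(j)})` with underlying subgroups `H¹_ur`, `H¹_tr`,
complementary, both `≃ₗ[R] (R/π^{e_j})²`.
[cite: Howard2004HeegnerKolyvagin, Prop. 1.1.9, §1.5, §1.6 (arXiv:1202.6340 p. 6 L17–25, p. 9 L105–108, p. 11 L33–44)] -/
theorem exists_unramified_transverse_submodules_of_mem_levelPrimes' (S : DVRSetting p K R N Rk Nbar Nq)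
    (hy : S.SatisfiesH) (hu : ¬ p ∣ Nat.card (𝓞 K)ˣ) {j : ℕ} {q : HeightOneSpectrum (𝓞 K)}
    (hq : q ∈ S.levelPrimes j) :
    letI := galoisCohomology.moduleH1 ((S.T.ρ j).toLocal (Sum.inr q))
      ((S.T.hlin j).restrictField (Place.Completion (Sum.inr q)))
    ∃ SVf SVtr : Submodule R (galoisCohomology ((S.T.ρ j).toLocal (Sum.inr q)) 1),
      SVf.toAddSubgroup = unramifiedSubgroup (GaloisRep.toLocal q (S.T.ρ j)) 1 ∧
      SVtr.toAddSubgroup = transverseStructure p (S.T.ρ j) S.jbar (Sum.inr q) ∧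
      IsCompl SVf SVtr ∧
      Nonempty (↥SVf ≃ₗ[R] (Fin 2 → R ⧸ Ideal.span {S.π ^ S.e j})) ∧
      Nonempty (↥SVtr ≃ₗ[R] (Fin 2 → R ⧸ Ideal.span {S.π ^ S.e j})) := by
  haveI : Finite (N j) := S.finite_level hy j
  have hn : ↑({q} : Finset (HeightOneSpectrum (𝓞 K))) ⊆ S.levelPrimes j := by
    rw [Finset.coe_singleton, Set.singleton_subset_iff]; exact hq
  have hρv : DiscreteGaloisModule.IsScalarLinear R (GaloisRep.toLocal q (S.T.ρ j)) :=
    (S.T.hlin j).restrictField (Place.Completion (Sum.inr q))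
  obtain ⟨Vtr, hVtr, hc, ⟨ef⟩, ⟨etr⟩⟩ :=
    exists_transverse_submodule_isCompl_linearEquiv_of_isDegreeTwo_of_not_dvd_card_units p hy.imagQuad hu (S.T.ρ j)
      S.jbar (S.isDegreeTwo_of_mem_L hy hq.1) hρv
      (fun g x => S.toLocal_apply_eq_self_of_subset_levelPrimes hy hn (Finset.mem_singleton_self q) g x)
      (S.exists_pow_p_smul_eq_zero_level hy j) (S.residueChar_succ_smul_eq_zero_of_mem_levelPrimes hy hq)
  obtain ⟨eN⟩ := S.nonempty_level_linearEquiv_pi hy j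
  exact ⟨DiscreteGaloisModule.unramifiedSubmodule hρv, Vtr, DiscreteGaloisModule.toAddSubgroup_unramifiedSubmodule hρv,
    hVtr, hc, ⟨ef.trans eN⟩, ⟨etr.trans eN⟩⟩

end DVRSetting

end DVR

end Literature.NumberTheory.GaloisCohomology.Howard2004

end
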